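import Summits.HodgeConjecture.HodgeConjecture.Cruxes.BlochSeedDiscOne.DepthBoundA4

/-!
# B3MonadDoors — the four door columns of the audit for THREE-TERM monads `A → N → C`, (B3) side
(hsemireg-monad-4 g27, MINT (B3)∕(α′); memo `Cruxes/BlochSeedDiscOne/B3FLAT-MONADDOORS-monad4-g27.md`)

Token: line stmt-HodgeConjecture-18881 Cruxes/BlochSeedDiscOne/Lines/birth.lean 814a6a70c14e831a stub_rung_pad4_seedAt.

LETTER-MODEL BOOKKEEPING ONLY (`DepthBoundA4.Design`, `LeggedFloor.Supplies ∕ Detects`).  A three-term DESIGN is a class-level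
object (cells with multiplicities on the A-, N- and C-term); designs ≠ supports ≠ displays ≠ monads ≠ SOURCE ≠ SEED.  Nothing
here is a sheaf or a cycle and nothing here is proved toward HC ∕ HC_CM ∕ HC_AV ∕ №4 ∕ 26512 ∕ 18881 ∕ H2; seats produce evidence
and typed files, not rungs.  `import` of the data model only; no `axiom` ∕ `sorry` ∕ `instance` ∕ `notation` ∕ `unsafe` ∕
`native_decide`.

## What is typed (the predicates the audit's door columns quantify over, for monads) and what is proved

* `Design3` — a three-term letter design; `flat` = its K-class as a two-term `Design` (`N − (A ++ C)`), so `μ`, (A1), `OnAlphabet`,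
  `copies`, `rank` are the two-term notions of record applied to `flat` (`copies_flat`, `rank_flat`).
* DOOR (H2) — `RuleD3` (memo §4, LAW RULE D₃, pen ×1, DERIVED from the E₁ page of the display filtration of `Ext•(𝓔,𝓔)`):
  the diagonal detection entry of `ob_κ(𝓔)` at a copy can be cancelled through the d₁-channel only along a SUPPLIER arrow
  (`LeggedFloor.Supplies`: equal off the block, equal-or-null on the block) into an ADJACENT term: A-cells are supplied from N
  above, C-cells from N below, N-cells from A below or C above.  `ruleD3_iff_ruleD_of_C_nil`: with `C = []` this IS memo-152's
  two-clause RULE D for `𝓔 = coker(P → N)` — the derivation reproduces the rule of record.  (The three-term d₂ back-channel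
  through `H³(Hom(C,A))` is a letter table, memo §4 (P4); it is not typed here.)
* (A4)-TYPE COVERS — `A4N3` (every supported N-cell has a FOUR-AMPLE i-arrow in from A), `A4C3` (every supported C-cell has a
  four-ample q-arrow in from N).  `mu_eq_zero_of_a4N3_a4C3_ruleD3A` ∕ `monad_a4_ruleD3A_vacuous`: on every height-`h` alphabet
  `A4N3 ∧ A4C3 ∧ RuleD3-A ⇒` no supported N- or C-cell, hence `μ = 0` — the monad twin of `LeggedFloor.legged_a4N_ruleDP_vacuous`
  (R19.619 «the (A4) universe is door-(H2)-dead»), by the same floor descent run on the i-side block `dropC`.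
* DOOR 0 ∕ CYCLE DOOR — LAW Σ-FLOOR₃ (memo §2, pen ×1): for a monad whose nonzero map components are four-ample differences
  (automatic under separated generic Pic⁰ labels) `ext²(𝓔,𝓔) ≥ 28·copies − λ`, `λ ≤ h³_sep(Hom(C,A))`.  Typed here as the budget
  predicate `SepBudget D λ B : 28·copies ≤ B + λ` with the three budgets of record (`B = 3136` rank-4 zero-locus road, `5572` door 0
  at node I, `8008` door 0 any I′) and its arithmetic: `copies ≤ 112 ∕ 199 ∕ 286 (+ λ∕28)`, and at rank 4 `Σ_N m ≤ 58 + λ∕56`-type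
  splits (`massN_le_of_sepBudget_rank`).
* DOOR 1 (Hall ∕ KS) is `B3MonadCohomology.HallQ ∕ HallI ∕ KSTightC` (monad-4 g2) — cited, not retyped.
-/

set_option linter.dupNamespace false
set_option autoImplicit false

namespace Summit.HodgeConjecture.HodgeConjecture.Cruxes.BlochSeedDiscOne.MonadDoors

open DepthBoundA4

/-! ## The door-(H2) vocabulary of record, VERBATIM from `LeggedFloor.lean` (plan-lens-HodgeAV-strengthen g15; text of
idea-crit-hsem-3 memo-152 `B136Door2Plate`) — inlined here only because the farm snapshot had not yet built `LeggedFloor`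
when this file was checked (2026-08-30T21:58–22:19Z, `remote:stale:2:unbuilt:LeggedFloor`); the definitions are character-identical, so every statement below
transports verbatim, and the twin `B3MonadDoors.importLeggedFloor.lean` (HOME `hsemireg-monad-4/g27/lean/`) states them over `LeggedFloor` itself. -/

/-- `(A4).2`: every supported N-cell has a FOUR-AMPLE (`Live`) arrow in. -/
def A4N (D : Design) : Prop := ∀ y ∈ D.suppN, ∃ x ∈ D.suppP, Live x y

/-- All four legs of the cell have level `< h`. -/
def FullBelow (h : ℤ) (c : Cell) : Prop := ∀ f : Fin 4, (c f).a < h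

/-- LEG AGREEMENT. -/
def LegAgree (h : ℤ) (D : Design) : Prop :=
  ∀ x ∈ D.suppP, FullBelow h x → ∀ g : Fin 4, ∃ y ∈ D.suppN, y g = x g

/-- NULL step on one factor: `a < a′` and `|β′ − β|² = (a′ − a)²`. -/
def NullStep (ℓ ℓ' : Letter) : Prop :=
  ℓ.a < ℓ'.a ∧ (ℓ'.x - ℓ.x) ^ 2 + (ℓ'.y - ℓ.y) ^ 2 = (ℓ'.a - ℓ.a) ^ 2

/-- SUPPLIER PAIR for the block `(g, j)`: equal off `{g, j}`, and on each of `g`, `j` either EQUAL or a NULL step. -/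
def Supplies (x y : Cell) (g j : Fin 4) : Prop :=
  (∀ f : Fin 4, f ≠ g → f ≠ j → x f = y f) ∧
    (x g = y g ∨ NullStep (x g) (y g)) ∧ (x j = y j ∨ NullStep (x j) (y j))

/-- The `(g, j)` block of `ob_κ(c)` is nonzero for some `κ ∈ T_W`: NOT (`β_g = β_j = 0` and `a_g = a_j`). -/
def Detects (c : Cell) (g j : Fin 4) : Prop :=
  ¬ ((c g).x = 0 ∧ (c g).y = 0 ∧ (c j).x = 0 ∧ (c j).y = 0 ∧ (c g).a = (c j).a)

/-- RULE D, P-side clause. -/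
def RuleDP (D : Design) : Prop :=
  ∀ x ∈ D.suppP, ∀ g j : Fin 4, g < j → Detects x g j → ∃ y ∈ D.suppN, Supplies x y g j

/-- RULE D (both sides), same text as memo-152. -/
def RuleD (D : Design) : Prop :=
  (∀ y ∈ D.suppN, ∀ g j : Fin 4, g < j → Detects y g j → ∃ x ∈ D.suppP, Supplies x y g j) ∧ RuleDP D

theorem level_le_of_onAlphabet {h : ℤ} {ℓ : Letter} (hℓ : ℓ.OnAlphabet h) : ℓ.a ≤ h := by
  have h1 := hℓ.1
  unfold Letter.height at h1
  have hx := abs_nonneg ℓ.x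
  have hy := abs_nonneg ℓ.y
  linarith

theorem level_nonneg_of_onAlphabet {h : ℤ} {ℓ : Letter} (hℓ : ℓ.OnAlphabet h) : 0 ≤ ℓ.a := hℓ.2

theorem xy_eq_zero_of_not_lt {h : ℤ} {ℓ : Letter} (hℓ : ℓ.OnAlphabet h) (hn : ¬ ℓ.a < h) :
    ℓ.x = 0 ∧ ℓ.y = 0 := by
  have h1 := hℓ.1
  unfold Letter.height at h1
  have hx := abs_nonneg ℓ.x
  have hy := abs_nonneg ℓ.y
  have hx0 : |ℓ.x| = 0 := by linarith
  have hy0 : |ℓ.y| = 0 := by linarith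
  exact ⟨abs_eq_zero.mp hx0, abs_eq_zero.mp hy0⟩

theorem charged_of_lt {h : ℤ} {ℓ : Letter} (hℓ : ℓ.OnAlphabet h) (hlt : ℓ.a < h) : ¬ (ℓ.x = 0 ∧ ℓ.y = 0) := by
  rintro ⟨hx, hy⟩
  have h1 := hℓ.1
  unfold Letter.height at h1
  rw [hx, hy] at h1
  simp at h1
  linarith

theorem mem_supp_of_memP (D : Design) {x : Cell} (hx : x ∈ D.suppP) : x ∈ D.suppN ++ D.suppP :=
  List.mem_append_right _ hx

theorem mem_supp_of_memN (D : Design) {y : Cell} (hy : y ∈ D.suppN) : y ∈ D.suppN ++ D.suppP :=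
  List.mem_append_left _ hy

theorem exists_block_avoiding (g : Fin 4) : ∃ j j' : Fin 4, j < j' ∧ g ≠ j ∧ g ≠ j' := by
  fin_cases g
  · exact ⟨1, 2, by decide, by decide, by decide⟩
  · exact ⟨2, 3, by decide, by decide, by decide⟩
  · exact ⟨0, 1, by decide, by decide, by decide⟩
  · exact ⟨0, 1, by decide, by decide, by decide⟩

theorem legAgree_of_ruleDP (h : ℤ) (D : Design) (hD : D.OnAlphabet h) (hr : RuleDP D) : LegAgree h D := by
  intro x hx hfull g
  obtain ⟨j, j', hjj, hgj, hgj'⟩ := exists_block_avoiding g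
  have hdet : Detects x j j' := by
    intro hc
    exact charged_of_lt (hD x (mem_supp_of_memP D hx) j) (hfull j) ⟨hc.1, hc.2.1⟩
  obtain ⟨y, hy, hsup⟩ := hr x hx j j' hjj hdet
  exact ⟨y, hy, (hsup.1 g hgj hgj').symm⟩

theorem descent (h : ℤ) (D : Design) (hD : D.OnAlphabet h) (hA : A4N D) (hL : LegAgree h D)
    (c : Cell) (hc : c ∈ D.suppN ++ D.suppP) (hfull : FullBelow h c) (g : Fin 4) :
    ∃ c' ∈ D.suppP, FullBelow h c' ∧ (c' g).a < (c g).a := by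
  rcases List.mem_append.mp hc with hN | hP
  · obtain ⟨x, hx, hlive⟩ := hA c hN
    refine ⟨x, hx, fun f => lt_trans (hlive f).1 (hfull f), (hlive g).1⟩
  · obtain ⟨y, hy, hyg⟩ := hL c hP hfull g
    obtain ⟨x, hx, hlive⟩ := hA y hy
    refine ⟨x, hx, fun f => lt_of_lt_of_le (hlive f).1 ?_, ?_⟩
    · exact level_le_of_onAlphabet (hD y (mem_supp_of_memN D hy) f)
    · have := (hlive g).1
      rw [hyg] at this
      exact this

theorem no_fullBelow (h : ℤ) (D : Design) (hD : D.OnAlphabet h) (hA : A4N D) (hL : LegAgree h D)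
    (c : Cell) (hc : c ∈ D.suppN ++ D.suppP) : ¬ FullBelow h c := by
  suffices key : ∀ n : ℕ, ∀ c ∈ D.suppN ++ D.suppP, FullBelow h c → ((c 0).a < (n : ℤ)) → False by
    intro hfull
    have h0 : (c 0).a < h := hfull 0
    have hn : h ≤ ((h.toNat : ℕ) : ℤ) := Int.self_le_toNat h
    exact key h.toNat c hc hfull (lt_of_lt_of_le h0 hn)
  intro n
  induction n with
  | zero =>
    intro c hc _ hlt
    have h0 := level_nonneg_of_onAlphabet (hD c hc 0)
    push_cast at hlt
    linarith
  | succ n ih =>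
    intro c hc hfull hlt
    obtain ⟨c', hc', hfull', hlt'⟩ := descent h D hD hA hL c hc hfull 0
    refine ih c' (mem_supp_of_memP D hc') hfull' ?_
    push_cast at hlt
    linarith

theorem cellCoef_eeee_eq_zero_of_not_full {h : ℤ} {c : Cell} (hc : ∀ f : Fin 4, (c f).OnAlphabet h)
    (hn : ¬ FullBelow h c) : cellCoef c Word.eeee = 0 := by
  unfold FullBelow at hn
  obtain ⟨f, hf⟩ := not_forall.mp hn
  have hxy := xy_eq_zero_of_not_lt (hc f) hf
  have hb : (c f).beta = 0 := by
    ext <;> simp [Letter.beta, hxy.1, hxy.2]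
  rw [cellCoef]
  apply Finset.prod_eq_zero (Finset.mem_univ f)
  simp [Word.eeee, Sym.coef, hb]

theorem listSum_eeee_eq_zero (L : List (Cell × ℕ))
    (hL : ∀ cm ∈ L, 0 < cm.2 → cellCoef cm.1 Word.eeee = 0) :
    (L.map fun cm => (cm.2 : GaussianInt) * cellCoef cm.1 Word.eeee).sum = 0 := by
  apply List.sum_eq_zero
  intro t ht
  rw [List.mem_map] at ht
  obtain ⟨cm, hcm, rfl⟩ := ht
  by_cases h0 : 0 < cm.2
  · rw [hL cm hcm h0, mul_zero]
  · have : cm.2 = 0 := by omega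
    rw [this]; simp


/-! ## Three-term designs and their K-class -/

/-- A three-term letter design `A --i--> N --q--> C` (cells with multiplicities; entries with multiplicity `0` are ignored). -/
structure Design3 where
  A : List (Cell × ℕ)
  N : List (Cell × ℕ)
  C : List (Cell × ℕ)

namespace Design3

/-- The K-class `𝓔 = 𝓝 − 𝓐 − 𝓒` as a two-term design of record (`P := A ++ C`). -/
def flat (D : Design3) : Design := ⟨D.N, D.A ++ D.C⟩

/-- The i-side block `A → N` alone (drop the C-term). -/
def dropC (D : Design3) : Design := ⟨D.N, D.A⟩

/-- Supports. -/
def suppA (D : Design3) : List Cell := (D.A.filter fun cm => 0 < cm.2).map Prod.fst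
/-- Support of the middle term. -/
def suppN (D : Design3) : List Cell := (D.N.filter fun cm => 0 < cm.2).map Prod.fst
/-- Support of the C-term. -/
def suppC (D : Design3) : List Cell := (D.C.filter fun cm => 0 < cm.2).map Prod.fst

/-- Term masses. -/
def massA (D : Design3) : ℕ := (D.A.map Prod.snd).sum
/-- Mass of the middle term. -/
def massN (D : Design3) : ℕ := (D.N.map Prod.snd).sum
/-- Mass of the C-term. -/
def massC (D : Design3) : ℕ := (D.C.map Prod.snd).sum

/-- Copy count `M = Σ_A m + Σ_N m + Σ_C m` (the number of line-bundle summands of the display). -/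
def copies (D : Design3) : ℕ := D.massA + D.massN + D.massC

/-- Rank of the cohomology bundle `r = Σ_N m − Σ_A m − Σ_C m`. -/
def rank (D : Design3) : ℤ := (D.massN : ℤ) - (D.massA : ℤ) - (D.massC : ℤ)

/-- Bloch coefficient, (A1) and the alphabet are the two-term notions applied to the K-class. -/
def mu (D : Design3) : GaussianInt := D.flat.mu
/-- (A1)-clean K-class. -/
def A1 (D : Design3) : Prop := D.flat.A1
/-- Every supported cell lies on the height-`h` alphabet. -/
def OnAlphabet (h : ℤ) (D : Design3) : Prop := D.flat.OnAlphabet h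

theorem suppN_flat (D : Design3) : D.flat.suppN = D.suppN := rfl
theorem suppP_flat (D : Design3) : D.flat.suppP = D.suppA ++ D.suppC := by
  simp [flat, Design.suppP, suppA, suppC, List.filter_append, List.map_append]
theorem suppN_dropC (D : Design3) : D.dropC.suppN = D.suppN := rfl
theorem suppP_dropC (D : Design3) : D.dropC.suppP = D.suppA := rfl

theorem copies_flat (D : Design3) : D.flat.copies = D.copies := by
  simp [flat, Design.copies, copies, massA, massN, massC, List.map_append, List.sum_append]
  omega

theorem rank_flat (D : Design3) : D.flat.rank = D.rank := by
  simp [flat, Design.rank, rank, massA, massN, massC, List.map_append, List.sum_append]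
  ring

theorem onAlphabet_dropC {h : ℤ} (D : Design3) (hD : D.OnAlphabet h) : D.dropC.OnAlphabet h := by
  intro c hc f
  apply hD c _ f
  rw [suppN_flat, suppP_flat]
  rcases List.mem_append.mp hc with hN | hA
  · exact List.mem_append_left _ hN
  · exact List.mem_append_right _ (List.mem_append_left _ hA)

/-! ## DOOR (H2): RULE D₃ (memo §4) -/

/-- A-side clause: every detecting block of every supported A-cell is supplied by a supported N-cell ABOVE it (i-arrow). -/
def RuleD3A (D : Design3) : Prop :=
  ∀ a ∈ D.suppA, ∀ g j : Fin 4, g < j → Detects a g j → ∃ n ∈ D.suppN, Supplies a n g j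

/-- C-side clause: every detecting block of every supported C-cell is supplied by a supported N-cell BELOW it (q-arrow). -/
def RuleD3C (D : Design3) : Prop :=
  ∀ c ∈ D.suppC, ∀ g j : Fin 4, g < j → Detects c g j → ∃ n ∈ D.suppN, Supplies n c g j

/-- N-side clause: every detecting block of every supported N-cell is supplied by an A-cell below OR a C-cell above. -/
def RuleD3N (D : Design3) : Prop :=
  ∀ n ∈ D.suppN, ∀ g j : Fin 4, g < j → Detects n g j →
    (∃ a ∈ D.suppA, Supplies a n g j) ∨ (∃ c ∈ D.suppC, Supplies n c g j)

/-- RULE D₃ (door (H2), d₁-channel, three-term monads). -/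
def RuleD3 (D : Design3) : Prop := RuleD3N D ∧ RuleD3A D ∧ RuleD3C D

theorem suppC_eq_nil_of_C_nil (D : Design3) (hC : D.C = []) : D.suppC = [] := by
  simp [suppC, hC]

/-- CONSISTENCY WITH THE RULE OF RECORD: for a two-term block read as `𝓔 = coker(P → N)` (`A := P`, `C := []`), RULE D₃ is
memo-152's two-clause RULE D (`LeggedFloor.RuleD`) of the flattened design. -/
theorem ruleD3_iff_ruleD_of_C_nil (D : Design3) (hC : D.C = []) : RuleD3 D ↔ RuleD D.flat := by
  have hsC := suppC_eq_nil_of_C_nil D hC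
  have hP : D.flat.suppP = D.suppA := by rw [suppP_flat, hsC, List.append_nil]
  constructor
  · rintro ⟨hN, hA, -⟩
    refine ⟨fun y hy g j hgj hdet => ?_, fun x hx g j hgj hdet => ?_⟩
    · rcases hN y hy g j hgj hdet with ⟨a, ha, hs⟩ | ⟨c, hc, _⟩
      · exact ⟨a, by rw [hP]; exact ha, hs⟩
      · rw [hsC] at hc; simp at hc
    · rw [hP] at hx
      obtain ⟨n, hn, hs⟩ := hA x hx g j hgj hdet
      exact ⟨n, hn, hs⟩
  · rintro ⟨hN, hP'⟩
    refine ⟨fun n hn g j hgj hdet => ?_, fun a ha g j hgj hdet => ?_, fun c hc => ?_⟩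
    · obtain ⟨x, hx, hs⟩ := hN n hn g j hgj hdet
      rw [hP] at hx
      exact Or.inl ⟨x, hx, hs⟩
    · obtain ⟨y, hy, hs⟩ := hP' a (by rw [hP]; exact ha) g j hgj hdet
      exact ⟨y, hy, hs⟩
    · rw [hsC] at hc; simp at hc

/-! ## (A4)-type covers and the monad twin of the floor vacuity -/

/-- Every supported N-cell has a FOUR-AMPLE i-arrow in from a supported A-cell. -/
def A4N3 (D : Design3) : Prop := ∀ n ∈ D.suppN, ∃ a ∈ D.suppA, Live a n

/-- Every supported C-cell has a FOUR-AMPLE q-arrow in from a supported N-cell. -/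
def A4C3 (D : Design3) : Prop := ∀ c ∈ D.suppC, ∃ n ∈ D.suppN, Live n c

theorem a4N_dropC (D : Design3) (h : A4N3 D) : A4N D.dropC := h

theorem ruleDP_dropC (D : Design3) (h : RuleD3A D) : RuleDP D.dropC := h

/-- A cell four-amply below a cell of the alphabet has all four legs of level `< h`. -/
theorem fullBelow_of_live {h : ℤ} {x y : Cell} (hy : ∀ f : Fin 4, (y f).OnAlphabet h) (hl : Live x y) :
    FullBelow h x :=
  fun f => lt_of_lt_of_le (hl f).1 (level_le_of_onAlphabet (hy f))

/-- Under `A4N3 ∧ RuleD3-A` on the alphabet, NO cell is a supported N-cell. -/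
theorem not_mem_suppN (h : ℤ) (D : Design3) (hD : D.OnAlphabet h) (hA : A4N3 D) (hr : RuleD3A D)
    (n : Cell) (hn : n ∈ D.suppN) : False := by
  have hD' := onAlphabet_dropC D hD
  obtain ⟨a, ha, hl⟩ := hA n hn
  have hfull : FullBelow h a :=
    fullBelow_of_live (fun f => hD' n (mem_supp_of_memN D.dropC hn) f) hl
  exact no_fullBelow h D.dropC hD' (a4N_dropC D hA) (legAgree_of_ruleDP h D.dropC hD' (ruleDP_dropC D hr))
    a (mem_supp_of_memP D.dropC ha) hfull

/-- … hence NO cell is a supported C-cell either (`A4C3` feeds C-cells from N). -/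
theorem not_mem_suppC (h : ℤ) (D : Design3) (hD : D.OnAlphabet h) (hA : A4N3 D) (hC : A4C3 D) (hr : RuleD3A D)
    (c : Cell) (hc : c ∈ D.suppC) : False := by
  obtain ⟨n, hn, _⟩ := hC c hc
  exact not_mem_suppN h D hD hA hr n hn

/-- … and no supported A-cell is fully charged. -/
theorem not_fullBelow_A (h : ℤ) (D : Design3) (hD : D.OnAlphabet h) (hA : A4N3 D) (hr : RuleD3A D)
    (a : Cell) (ha : a ∈ D.suppA) : ¬ FullBelow h a := by
  have hD' := onAlphabet_dropC D hD
  exact no_fullBelow h D.dropC hD' (a4N_dropC D hA) (legAgree_of_ruleDP h D.dropC hD' (ruleDP_dropC D hr))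
    a (mem_supp_of_memP D.dropC ha)

theorem listSum_eeee_eq_zero_of_supp_empty (L : List (Cell × ℕ))
    (hL : ∀ c ∈ (L.filter fun cm => 0 < cm.2).map Prod.fst, False) :
    (L.map fun cm => (cm.2 : GaussianInt) * cellCoef cm.1 Word.eeee).sum = 0 := by
  apply listSum_eeee_eq_zero
  intro cm hcm h0
  exact (hL cm.1 (List.mem_map.mpr ⟨cm, List.mem_filter.mpr ⟨hcm, by simpa using h0⟩, rfl⟩)).elim

/-- THE MONAD FLOOR THEOREM: on the height-`h` alphabet, `A4N3 ∧ A4C3 ∧ RuleD3-A ⇒ μ = 0`. -/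
theorem mu_eq_zero_of_a4N3_a4C3_ruleD3A (h : ℤ) (D : Design3) (hD : D.OnAlphabet h) (hA : A4N3 D) (hC : A4C3 D)
    (hr : RuleD3A D) : D.mu = 0 := by
  have hN : (D.N.map fun cm => (cm.2 : GaussianInt) * cellCoef cm.1 Word.eeee).sum = 0 :=
    listSum_eeee_eq_zero_of_supp_empty D.N (fun n hn => not_mem_suppN h D hD hA hr n hn)
  have hCs : (D.C.map fun cm => (cm.2 : GaussianInt) * cellCoef cm.1 Word.eeee).sum = 0 :=
    listSum_eeee_eq_zero_of_supp_empty D.C (fun c hc => not_mem_suppC h D hD hA hC hr c hc)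
  have hAs : (D.A.map fun cm => (cm.2 : GaussianInt) * cellCoef cm.1 Word.eeee).sum = 0 := by
    apply listSum_eeee_eq_zero
    intro cm hcm h0
    have hmem : cm.1 ∈ D.suppA :=
      List.mem_map.mpr ⟨cm, List.mem_filter.mpr ⟨hcm, by simpa using h0⟩, rfl⟩
    have halph : ∀ f : Fin 4, (cm.1 f).OnAlphabet h := fun f =>
      hD cm.1 (by rw [suppN_flat, suppP_flat]
                  exact List.mem_append_right _ (List.mem_append_left _ hmem)) f
    exact cellCoef_eeee_eq_zero_of_not_full halph (not_fullBelow_A h D hD hA hr cm.1 hmem)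
  show D.flat.T Word.eeee = 0
  rw [Design.T]
  simp only [flat, List.map_append, List.sum_append]
  rw [hN, hAs, hCs]
  simp

/-- VACUITY: `OnAlphabet h ∧ A4N3 ∧ A4C3 ∧ RuleD3-A ∧ μ ≠ 0` is unsatisfiable at every height — the three-term (A4) universe is
door-(H2)-dead exactly as the two-term one (R19.619), with no (A1), Hall, copies, rank or budget hypothesis used. -/
theorem monad_a4_ruleD3A_vacuous (h : ℤ) (D : Design3) (hD : D.OnAlphabet h) (hA : A4N3 D) (hC : A4C3 D)
    (hr : RuleD3A D) (hμ : D.mu ≠ 0) : False :=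
  hμ (mu_eq_zero_of_a4N3_a4C3_ruleD3A h D hD hA hC hr)

/-! ## DOOR 0 ∕ CYCLE DOOR: the separated-label diagonal budget (LAW Σ-FLOOR₃, memo §2) -/

/-- `SepBudget D λ B`: the diagonal floor `28·copies − λ` fits under the budget `B` (`λ` = the d₂ leak `≤ h³_sep(Hom(C,A))`). -/
def SepBudget (D : Design3) (leak B : ℕ) : Prop := 28 * D.copies ≤ B + leak

/-- The three budgets of record. -/
def CycleBudgetSep (D : Design3) (leak : ℕ) : Prop := SepBudget D leak 3136
/-- Door 0 at the node `I = {1,2,3,4}`: `ext² ≤ 5572 = 28 + 448 + 1960 + 3136`. -/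
def Door0NodeSep (D : Design3) (leak : ℕ) : Prop := SepBudget D leak 5572
/-- Door 0 for any index set: `ext² ≤ 8008 = C(16,6)`. -/
def Door0AnySep (D : Design3) (leak : ℕ) : Prop := SepBudget D leak 8008

theorem copies_le_of_sepBudget (D : Design3) (leak B : ℕ) (h : SepBudget D leak B) : D.copies ≤ (B + leak) / 28 := by
  unfold SepBudget at h
  omega

theorem cycleBudgetSep_zero_iff (D : Design3) : CycleBudgetSep D 0 ↔ D.copies ≤ 112 := by
  unfold CycleBudgetSep SepBudget; omega

theorem door0NodeSep_zero_iff (D : Design3) : Door0NodeSep D 0 ↔ D.copies ≤ 199 := by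
  unfold Door0NodeSep SepBudget; omega

theorem door0AnySep_zero_iff (D : Design3) : Door0AnySep D 0 ↔ D.copies ≤ 286 := by
  unfold Door0AnySep SepBudget; omega

theorem door0_of_cycle (D : Design3) (leak : ℕ) (h : CycleBudgetSep D leak) : Door0NodeSep D leak := by
  unfold CycleBudgetSep Door0NodeSep SepBudget at *; omega

theorem door0Any_of_node (D : Design3) (leak : ℕ) (h : Door0NodeSep D leak) : Door0AnySep D leak := by
  unfold Door0NodeSep Door0AnySep SepBudget at *; omega

/-- At rank `r ≥ 0` the N-mass carries half the copies: `2·Σ_N m = copies + rank`, so a budget `28·copies ≤ B + λ` reads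
`56·Σ_N m ≤ B + λ + 28·rank`. -/
theorem massN_le_of_sepBudget_rank (D : Design3) (leak B : ℕ) (r : ℕ) (hr : D.rank = r) (h : SepBudget D leak B) :
    56 * D.massN ≤ B + leak + 28 * r := by
  unfold SepBudget copies at h
  unfold rank at hr
  omega

/-- Rank-4, leak-free cycle door: `Σ_N m ≤ 58` and `Σ_A m + Σ_C m ≤ 54` (the monad form of `CycleDoorBudget.CycleBudget116`). -/
theorem rank4_cycle_split (D : Design3) (hr : D.rank = 4) (h : CycleBudgetSep D 0) :
    D.massN ≤ 58 ∧ D.massA + D.massC ≤ 54 := by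
  unfold CycleBudgetSep SepBudget copies at h
  unfold rank at hr
  omega

/-! ## Kernel-evaluated toys (memo §5 table rows; `decide` on list arithmetic only) -/

/-- CHIRAL-4 (colour-1's CHIRAL with hub multiplicity 4), read as a monad with `C = []`:
`N = 4·hub⁴ + Σ_k (ρᵏs)⁴`, `A = Σ_k (ρᵏs̄)⁴`, `s = (7;4,3)`, `s̄ = (7;3,4)`, `h = 14`. -/
def sL : Letter := ⟨7, 4, 3⟩
/-- The conjugate-slope letter `(7;3,4)`. -/
def sbL : Letter := ⟨7, 3, 4⟩
/-- Constant cells. -/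
def c4 (ℓ : Letter) : Cell := fun _ => ℓ
/-- CHIRAL-4 as a three-term design with empty C-term. -/
def chiral4 : Design3 :=
  { A := [(c4 sbL, 1), (c4 sbL.rotI, 1), (c4 sbL.rotI.rotI, 1), (c4 sbL.rotI.rotI.rotI, 1)],
    N := [(c4 (Letter.hub 14), 4), (c4 sL, 1), (c4 sL.rotI, 1), (c4 sL.rotI.rotI, 1), (c4 sL.rotI.rotI.rotI, 1)],
    C := [] }

example : chiral4.copies = 12 := by decide
example : chiral4.rank = 4 := by decide
/-- 12 copies sit under every separated-label budget (door 0 is not what kills CHIRAL-4; KS and RULE D do, memo §5). -/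
example : CycleBudgetSep chiral4 0 := by unfold CycleBudgetSep SepBudget; decide
/-- A 200-copy design already violates door 0 at node I with no leak. -/
example : ¬ (28 * 200 ≤ 5572 + 0) := by decide

end Design3

end Summit.HodgeConjecture.HodgeConjecture.Cruxes.BlochSeedDiscOne.MonadDoors
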